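import Mathlib
import Summits.KontsevichZagierPeriods.Zeta5Search.Families.SeatingGapGrowth
import Summits.KontsevichZagierPeriods.Zeta5Search.Families.GaussCongruence
import Summits.KontsevichZagierPeriods.Zeta5Search.Families.CubicalChartLeadPi1Pi8
import Summits.KontsevichZagierPeriods.Zeta5Search.Families.CubicalChartLeadPi2
import Summits.KontsevichZagierPeriods.Zeta5Search.Families.CubicalChartLeadPi4
import Summits.KontsevichZagierPeriods.Zeta5Search.Families.CubicalChartLeadPi6
import Summits.KontsevichZagierPeriods.Zeta5Search.Families.CubicalChartLeadPi7
import Summits.KontsevichZagierPeriods.Zeta5Search.Families.CubicalChartLeadPi9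
import Summits.KontsevichZagierPeriods.Zeta5Search.Families.CubicalChartLeadPi10
import Summits.KontsevichZagierPeriods.Zeta5Search.Families.CubicalChartLeadPi8vRate
import HarnessLib

/-!
# ζ(5) search — Families: Gauss congruences for the diagonal gap constant terms of EVERY seating, and for all `N = 8` leading coefficients

HONEST FRAMING: systematic search; no irrationality claim unless certified.  Cell `pub-zeta5`, seat P2 g10 (Families
layer), 2026-08-23.  Congruences between integers; nothing about the arithmetic of any zeta value; no record moves; no
conjecture node is used or discharged (the census recurrences `Brown8.LeadRec_<class>` stay GUESSED and are not used).
The mathematics is classical (constant terms of powers of an integral Laurent polynomial satisfy the Gauss congruences,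
[cite: BeukersHoubenStraub2018, §1]; kernel form = fam-tele g13's `GaussCT.gauss_of_eq_coeff_smul_pow`,
`Families/GaussCongruence`); here it is APPLIED UNIFORMLY:
* **`SeatingGap.gapCT_gauss`** — for EVERY seating `τ` of any size (cert-2 g11's `Families/SeatingGapGrowth`: diagonal gap
  constant term `gapCT τ n = [X^{n·𝟙}] (gapPoly τ 1)ⁿ`, `gapPoly_eq_pow`), the sequence `n ↦ gapCT τ n` satisfies
  `pʳ ∣ gapCT τ (m pʳ) − gapCT τ (m pʳ⁻¹)` for every prime `p` and all `m, r`; `gapCT_gauss_prime`: `gapCT τ p ≡ gapCT τ 1 (mod p)`;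
* hence, through cert-2 g11's identifications `lead_<class> n = gapCT τ n` (`Families/CubicalChartLead*`), the census
  leading-coefficient sequences of ALL thirteen non-degenerate `N = 8` configurations and of `₈π₈`, `₈π₈^∨`, `₈π₁`
  (`Brown8/LeadingCoefficientsA,B`: `lead_pi1, lead_pi2, lead_pi4, lead_pi4v, lead_pi6, lead_pi7, lead_pi7v, lead_pi8,
  lead_pi8v, lead_pi9, lead_pi9v, lead_pi10, lead_pi10v`) satisfy the Gauss congruences for EVERY prime
  (`lead_pi6_gauss`, …) — the all-primes `mod pʳ` floor under [MccarthyOsburnStraub2018, Conjecture 1.3]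
  (`A_σ(m pʳ) ≡ A_σ(m pʳ⁻¹) (mod p^{3r})`, `p ≥ 5`, every convergent `σ`), which is NOT claimed.
Standard axioms only.
-/

namespace Summit.KontsevichZagierPeriods.Zeta5Search.Families.Cellular

namespace SeatingGap

variable {ℓ : ℕ} (τ : Fin (ℓ + 3) → Fin (ℓ + 3))

/-- **Gauss congruences for the diagonal gap constant terms of every seating** (UNCONDITIONAL, every prime):
`pʳ ∣ gapCT τ (m pʳ) − gapCT τ (m pʳ⁻¹)`. -/
theorem gapCT_gauss {p : ℕ} (hp : p.Prime) (m r : ℕ) :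
    ((p : ℤ) ^ r) ∣ gapCT τ (m * p ^ r) - gapCT τ (m * p ^ (r - 1)) :=
  GaussCT.gauss_of_eq_coeff_smul_pow (gapCT τ) (gapPoly τ 1) (ones (ℓ + 1))
    (fun n => by rw [gapCT, gapPoly_eq_pow]) hp m r

/-- `gapCT τ p ≡ gapCT τ 1 (mod p)` for every prime `p`. -/
theorem gapCT_gauss_prime {p : ℕ} (hp : p.Prime) : (p : ℤ) ∣ gapCT τ p - gapCT τ 1 := by
  simpa using gapCT_gauss τ hp 1 1

end SeatingGap

/-! ## The `N = 8` census leading coefficients (cert-2 g11's `lead = gapCT` identities) -/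

namespace CubicalChartN

open Summit.KontsevichZagierPeriods.Zeta5Search.Brown8

/-- Transfer: a sequence equal to some `gapCT τ` satisfies the Gauss congruences. -/
theorem gauss_of_eq_gapCT {ℓ : ℕ} (u : ℕ → ℤ) (τ : Fin (ℓ + 3) → Fin (ℓ + 3)) (hu : ∀ n, u n = SeatingGap.gapCT τ n)
    {p : ℕ} (hp : p.Prime) (m r : ℕ) : ((p : ℤ) ^ r) ∣ u (m * p ^ r) - u (m * p ^ (r - 1)) := by
  rw [hu, hu]; exact SeatingGap.gapCT_gauss τ hp m r

/-- Gauss congruences for `lead_pi1` (class `₈π₁`), every prime. -/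
theorem lead_pi1_gauss {p : ℕ} (hp : p.Prime) (m r : ℕ) :
    ((p : ℤ) ^ r) ∣ lead_pi1 (m * p ^ r) - lead_pi1 (m * p ^ (r - 1)) :=
  gauss_of_eq_gapCT _ _ lead_pi1_eq_gapCT hp m r
/-- Gauss congruences for `lead_pi2` (class `₈π₂ = ₈π₃`), every prime. -/
theorem lead_pi2_gauss {p : ℕ} (hp : p.Prime) (m r : ℕ) :
    ((p : ℤ) ^ r) ∣ lead_pi2 (m * p ^ r) - lead_pi2 (m * p ^ (r - 1)) :=
  gauss_of_eq_gapCT _ _ lead_pi2_eq_gapCT hp m r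
/-- Gauss congruences for `lead_pi4` (class `₈π₄ = ₈π₅`), every prime. -/
theorem lead_pi4_gauss {p : ℕ} (hp : p.Prime) (m r : ℕ) :
    ((p : ℤ) ^ r) ∣ lead_pi4 (m * p ^ r) - lead_pi4 (m * p ^ (r - 1)) :=
  gauss_of_eq_gapCT _ _ lead_pi4_eq_gapCT hp m r
/-- Gauss congruences for `lead_pi4v` (class `₈π₄^∨ = ₈π₅^∨`), every prime. -/
theorem lead_pi4v_gauss {p : ℕ} (hp : p.Prime) (m r : ℕ) :
    ((p : ℤ) ^ r) ∣ lead_pi4v (m * p ^ r) - lead_pi4v (m * p ^ (r - 1)) :=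
  gauss_of_eq_gapCT _ _ lead_pi4v_eq_gapCT hp m r
/-- Gauss congruences for `lead_pi6` (class `₈π₆`; [MccarthyOsburnStraub2018, Prop. 3.1]'s `A_{σ₈}`), every prime. -/
theorem lead_pi6_gauss {p : ℕ} (hp : p.Prime) (m r : ℕ) :
    ((p : ℤ) ^ r) ∣ lead_pi6 (m * p ^ r) - lead_pi6 (m * p ^ (r - 1)) :=
  gauss_of_eq_gapCT _ _ lead_pi6_eq_gapCT hp m r
/-- Gauss congruences for `lead_pi7` (class `₈π₇`), every prime. -/
theorem lead_pi7_gauss {p : ℕ} (hp : p.Prime) (m r : ℕ) :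
    ((p : ℤ) ^ r) ∣ lead_pi7 (m * p ^ r) - lead_pi7 (m * p ^ (r - 1)) :=
  gauss_of_eq_gapCT _ _ lead_pi7_eq_gapCT hp m r
/-- Gauss congruences for `lead_pi7v` (class `₈π₇^∨`), every prime. -/
theorem lead_pi7v_gauss {p : ℕ} (hp : p.Prime) (m r : ℕ) :
    ((p : ℤ) ^ r) ∣ lead_pi7v (m * p ^ r) - lead_pi7v (m * p ^ (r - 1)) :=
  gauss_of_eq_gapCT _ _ lead_pi7v_eq_gapCT hp m r
/-- Gauss congruences for `lead_pi8` (class `₈π₈` = the very-well-poised cell), every prime. -/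
theorem lead_pi8_gauss {p : ℕ} (hp : p.Prime) (m r : ℕ) :
    ((p : ℤ) ^ r) ∣ lead_pi8 (m * p ^ r) - lead_pi8 (m * p ^ (r - 1)) :=
  gauss_of_eq_gapCT _ _ lead_pi8_eq_gapCT hp m r
/-- Gauss congruences for `lead_pi8v` (class `₈π₈^∨` = Brown–Zudilin's cell; = Zudilin's `Qₙ`, cf. fam-tele's `Q_gauss`), every prime. -/
theorem lead_pi8v_gauss {p : ℕ} (hp : p.Prime) (m r : ℕ) :
    ((p : ℤ) ^ r) ∣ lead_pi8v (m * p ^ r) - lead_pi8v (m * p ^ (r - 1)) :=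
  gauss_of_eq_gapCT _ _ lead_pi8v_eq_gapCT hp m r
/-- Gauss congruences for `lead_pi9` (class `₈π₉`), every prime. -/
theorem lead_pi9_gauss {p : ℕ} (hp : p.Prime) (m r : ℕ) :
    ((p : ℤ) ^ r) ∣ lead_pi9 (m * p ^ r) - lead_pi9 (m * p ^ (r - 1)) :=
  gauss_of_eq_gapCT _ _ lead_pi9_eq_gapCT hp m r
/-- Gauss congruences for `lead_pi9v` (class `₈π₉^∨`), every prime. -/
theorem lead_pi9v_gauss {p : ℕ} (hp : p.Prime) (m r : ℕ) :
    ((p : ℤ) ^ r) ∣ lead_pi9v (m * p ^ r) - lead_pi9v (m * p ^ (r - 1)) :=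
  gauss_of_eq_gapCT _ _ lead_pi9v_eq_gapCT hp m r
/-- Gauss congruences for `lead_pi10` (class `₈π₁₀`), every prime. -/
theorem lead_pi10_gauss {p : ℕ} (hp : p.Prime) (m r : ℕ) :
    ((p : ℤ) ^ r) ∣ lead_pi10 (m * p ^ r) - lead_pi10 (m * p ^ (r - 1)) :=
  gauss_of_eq_gapCT _ _ lead_pi10_eq_gapCT hp m r
/-- Gauss congruences for `lead_pi10v` (class `₈π₁₀^∨`), every prime. -/
theorem lead_pi10v_gauss {p : ℕ} (hp : p.Prime) (m r : ℕ) :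
    ((p : ℤ) ^ r) ∣ lead_pi10v (m * p ^ r) - lead_pi10v (m * p ^ (r - 1)) :=
  gauss_of_eq_gapCT _ _ lead_pi10v_eq_gapCT hp m r

/-- Kernel instance: `lead_pi6 p ≡ 33 (mod p)` for every prime (`gapCT tau6 1 = 33`, cert-2 g11). -/
theorem lead_pi6_prime_sub_33 {p : ℕ} (hp : p.Prime) : (p : ℤ) ∣ lead_pi6 p - 33 := by
  have h := lead_pi6_gauss hp 1 1
  rw [pow_one, pow_one, one_mul, Nat.sub_self, pow_zero, mul_one, lead_pi6_eq_gapCT 1, gapCT_tau6_one] at h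
  exact h

end CubicalChartN

end Summit.KontsevichZagierPeriods.Zeta5Search.Families.Cellular
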